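import Summits.QuantumFields.YangMills.Theorems.LuscherReductionTwistedTraceScalingBTColourFPReduction
import Summits.QuantumFields.YangMills.Theorems.TwistedTraceScaling.Negative.AvgKernelNoLabSlowFactor
import Summits.QuantumFields.YangMills.Theorems.TwistedTraceScaling.Negative.AvgKernelStiffFlip
import HarnessLib

/-!
# R38 — the Faddeev–Popov weight must PIN the colour frame: for every colour-invariant weight `W` (in particular the trivial weight `W ≡ 1`, for which
# `fpBOKernel = 𝒦`) the pointwise hypothesis `hpt` of lane A's `boKernel_pointwise_of_fp` / `hT_of_fp` is unsatisfiable on the record window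
(crux `LuscherReduction.TwistedTraceScaling`, stmt-QuantumFields-20203; standing disprover, cycle 30; vets lane A g14's p654332 `…BTPointwise`, p655712 `…BTColourFP`,
p656084 `…BTColourFPReduction` and COARSE-DESIGN §25)

VETTED: `hT_of_fp` — (B-T) ⟸ `∀ᶠ β, ∀ u u' ∈ {orbitDist < recordDelta1 L s β}: |fpBOKernel β Ω W u u' − C·K₁^{(L³β)}(u,u')| ≤ κ·C·K₁^{(L³β)}(u,u')` for a weight `W` on the
gauge group whose colour-orbit integral is constant (`hZ : ∫_c W(c·g) dc = Z > 0`), `K₁` the RAW one-site kernel.  The side conditions on `W` (`hW`, `hCW`, `hZ0`, `hZ`) are met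
by the CONSTANT weights (plain gauge averaging; `Z = W`), and a LEFT-COLOUR-INVARIANT weight (`W(c·g) = W(g)`) meets `hZ` iff it is constant (`∫_c W(c·g) dc = W(g)`): the typed
interface says «a transversal density of mass `Z` on every colour orbit», not WHICH transversal — every admissible non-constant `W` breaks colour invariance, i.e. pins a frame.
FINDING (load-bearing analysis, kernel-checked).  ★ `fpBOKernel_conj_left`: for a left-colour-invariant weight and colour-blind `Ω` the colour-localised BO kernel is SEPARATELY
conjugation invariant in its left slow slot, `fpBOKernel(cuc⁻¹, u') = fpBOKernel(u, u')` (invariance of `π`, of the gauge-group Haar measure and of `K_β`; cdisprove R33's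
`gaugeTransform_const_orthoTube`); ★ `boKernel_eq_fpBOKernel_one`: with `W ≡ 1` it IS lane A's BO kernel `𝒦_β` (`boKernel_fp` at `Z = 1`).  Hence R32's Weyl flip bites the RAW
one-site target: ★★ `flip_constraint_of_hpt` — `hpt` on a window `{orbitDist < δ}` with `C > 0` forces `1 − κ ≤ (1 + κ)·exp(−B(2 − 2cos 2θ)|Edge 3 1|)` for every flip pair
`u_{±θ} = (diagSU2(±θ))_k` in the window (`3√2|θ| < δ`); ★★★ `not_hpt_of_colourInvariant` — on the record window `recordDelta1 L s β = 14β^{−s}/|Site|` with the record coupling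
`B = L³β`, `0 ≤ s < 1/2`, eventual `C β > 0` and `κ β ≤ κ₀ < 1`, the `∀ᶠ β` hypothesis `hpt` of `hT_of_fp` is FALSE for every left-colour-invariant `W β` (`θ_β = β^{−s}/|Site|`,
`Bθ_β² = L³β^{1−2s}/|Site|² → ∞`; `hZ` is not used); ★★★ `not_hpt_trivial_weight` — in particular for `W ≡ 1`: `|𝒦_β − C·K₁^{(L³β)}| ≤ κ·C·K₁^{(L³β)}` pointwise on the window
is impossible (R32's «no LAB slow factor», now for the BO kernel of record and lane A's exact `hpt` shape).
READING (no kill).  Lane A's weight of record `W_β = 𝟙{μ(g) ∈ B_{β⁻¹}(1)}` (polar colour mean, COARSE-DESIGN §25.2) is a genuine transversal — the theorem does not touch it; it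
certifies that the PIN is the load-bearing content of `W`: the constant weights (comparing `𝒦_β` itself with the raw `K₁`) are dead for every `s < 1/2` by the kinetic cost
`β^{1−2s}` of a Weyl flip inside the window, and a colour-invariant localisation near the constants (`𝟙_S`, `S = {∀x, ‖g_x μ(g)⁻¹ − 1‖ < r}`, or any function of the relative
colours `g_x⁻¹g_y`) is neither admissible (`hZ`) nor rescued by dropping `hZ`; the amount by which `W` breaks left-colour invariance is what (B-T) lives on (§25.2's slab term
`12|Site|β^{−2s}` is that amount for the record pin).  Paper remarks on §25.3/§25.5 in the disprover's work file (VERDICT 30): (a) the `Ξ`-mode is near-flat (width `≫ β^{−1/2}`),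
so the hard cut `ε = β^{−1}` gives a `u`-independent slab factor `Vol·(1 ± O(|Site|δ₁²))`; (b) off the slice the phase kernel is `6|Site| − 3`-dimensional (constant `ξ ∈ ker d`),
on the slice `6(|Site| − 1)` with `ker ∩ ker(P_Γ ⊕ P_Γ) = 0`; (c) every first-order slow variation of the quadratic form is of colour type `ad` (trace zero against the colour-blind
`𝐐₀⁻¹`) or a colour scalar of second order — chart-Jacobian terms included (Schur: an `SO(3)`-invariant ensemble has no invariant vector and only `δ^{ab}` as invariant 2-tensor,
so Gaussianity of `Ω` is not needed).
HONEST FRAMING: exact symmetry bookkeeping plus R32's explicit flip on a fixed lattice, about the typed hypotheses of lane A's own reduction for stub S-BASE/C4-CORE of a child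
of the CONDITIONAL reduction route R2b1 (`LuscherReduction`); no registered statement refuted or proved; the Laplace core of (B-T) and C4 are OPEN; not infinite volume, not a
gap, not Clay.

## References
* E. Seiler, *Gauge Theories as a Problem of Constructive Quantum Field Theory and Statistical Mechanics*, LNP 159 (1982), §2–§3 (gauge fixing à la Faddeev–Popov on the
  lattice; transfer matrix and Gauss law by averaging over all gauge transformations). [SeilerLNP1982]
* M. Lüscher, Some analytic results concerning the mass spectrum of Yang–Mills gauge theories on a torus, Nucl. Phys. B219 (1983) 233–261, §3 (constant modes; the residual
  global colour group). [Luscher1983]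
* T. Bröcker, T. tom Dieck, *Representations of Compact Lie Groups*, GTM 98 (1985), I (1.10) (`Ad : SU(2) → SO(3)`, the Weyl flip of the maximal torus). [BrockerTomDieck1985]
-/

set_option autoImplicit false

noncomputable section

open MeasureTheory Real Filter Topology
open scoped BigOperators
open Literature.MathematicalPhysics.QuantumFieldTheory hiding SU2
open Literature.MathematicalPhysics.QuantumLattice

namespace Summit.QuantumFields.YangMills.Theorems.TwistedTraceScaling.Negative.R38

open Summit.QuantumFields.YangMills.Theorems.FemtoTransferGap
open Summit.QuantumFields.YangMills.Theorems.FemtoTransferGap.TwoLattice.Toron (frobNorm_diagSU2_sub_one_le)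
open Summit.QuantumFields.YangMills.Theorems.FemtoTransferGap.TwoLattice.Avg
open Summit.QuantumFields.YangMills.Theorems.FemtoTransferGap.TwoLattice.ConstTube
open Summit.QuantumFields.YangMills.Theorems.FemtoTransferGap.TwoLattice.Stiff (LinkSpace)
open Summit.QuantumFields.YangMills.Theorems.TwistedTraceScaling.Negative.R32 (exists_weylFlip oneSite_diag_neg_eq_gaugeTransform
  transferKernel_constDiag_flip sq_le_two_sub_two_cos_two_mul)
open Summit.QuantumFields.YangMills.Theorems.TwistedTraceScaling.Negative.R33 (gaugeTransform_const_orthoTube)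

variable {L : ℕ} [NeZero L]

/-! ## §1 A colour-invariant weight leaves `fpBOKernel` separately conjugation invariant; the trivial weight gives back `𝒦` -/

/-- The `v`-section of the `fpBOKernel` integrand is measurable (lane A's measurability chain, at colour `1`). [folklore] -/
theorem measurable_fpSection (β : ℝ) {Ω : LinkSpace L → ℝ} (hΩm : Measurable Ω) {W : (Site 3 L → SU2) → ℝ} (hW : Measurable W)
    (u₀ u' : GaugeConfig 3 1 SU2) :
    Measurable fun w : Edge 3 L → Fin 3 → ℝ => Ω (linkEmbed L w) *
      ∫ v', (∫ g, W g * transferKernel su2Rep β (orthoTube L u₀ w) (gaugeTransform g (orthoTube L u' v')) ∂gaugeMeasure L) *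
        Ω (linkEmbed L v') ∂orthoTransverse L := by
  haveI := isFiniteMeasure_orthoTransverse L
  haveI : SecondCountableTopology SU2 := secondCountableTopology_su2
  have h4 := measurable_fp_integrand (L := L) β hW u₀ u'
  have hG := (h4.stronglyMeasurable.integral_prod_right' (ν := gaugeMeasure L)).measurable
  have hG' : Measurable fun t : ((Edge 3 L → Fin 3 → ℝ) × (Edge 3 L → Fin 3 → ℝ)) × SU2 =>
      ∫ g, W g * transferKernel su2Rep β (gaugeTransform (fun _ : Site 3 L => t.2⁻¹) (orthoTube L u₀ t.1.1))
        (gaugeTransform g (orthoTube L u' t.1.2)) ∂gaugeMeasure L := by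
    simpa only using hG
  have hsec : Measurable fun r : (Edge 3 L → Fin 3 → ℝ) × (Edge 3 L → Fin 3 → ℝ) =>
      (∫ g, W g * transferKernel su2Rep β (gaugeTransform (fun _ : Site 3 L => (1 : SU2)⁻¹) (orthoTube L u₀ r.1))
        (gaugeTransform g (orthoTube L u' r.2)) ∂gaugeMeasure L) * Ω (linkEmbed L r.2) := by
    have hp : Measurable fun r : (Edge 3 L → Fin 3 → ℝ) × (Edge 3 L → Fin 3 → ℝ) =>
        ((r, (1 : SU2)) : ((Edge 3 L → Fin 3 → ℝ) × (Edge 3 L → Fin 3 → ℝ)) × SU2) := measurable_id.prodMk measurable_const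
    have h := hG'.comp hp
    have h' : Measurable fun r : (Edge 3 L → Fin 3 → ℝ) × (Edge 3 L → Fin 3 → ℝ) =>
        ∫ g, W g * transferKernel su2Rep β (gaugeTransform (fun _ : Site 3 L => (1 : SU2)⁻¹) (orthoTube L u₀ r.1))
          (gaugeTransform g (orthoTube L u' r.2)) ∂gaugeMeasure L := by
      simpa only [Function.comp_def] using h
    exact h'.mul (hΩm.comp ((measurable_linkEmbed L).comp measurable_snd))
  have hone : ∀ U : GaugeConfig 3 L SU2, gaugeTransform (fun _ : Site 3 L => (1 : SU2)⁻¹) U = U := fun U => by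
    rw [inv_one]; exact TT.gaugeTransform_one' U
  simp only [hone] at hsec
  have hI := (hsec.stronglyMeasurable.integral_prod_right' (ν := orthoTransverse L)).measurable
  have hI' : Measurable fun w : Edge 3 L → Fin 3 → ℝ =>
      ∫ v', (∫ g, W g * transferKernel su2Rep β (orthoTube L u₀ w) (gaugeTransform g (orthoTube L u' v')) ∂gaugeMeasure L) *
        Ω (linkEmbed L v') ∂orthoTransverse L := by
    simpa only using hI
  exact (hΩm.comp (measurable_linkEmbed L)).mul hI'

omit [NeZero L] in
/-- For a LEFT-COLOUR-INVARIANT weight the weighted gauge-orbit integral does not see a constant left factor on the gauge transformation: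
`∫ W(g)·K_β(U, (c·g)·V) dg = ∫ W(g)·K_β(U, V^g) dg` (left invariance of the gauge-group Haar measure). [cite: SeilerLNP1982, §2] -/
theorem gaugeIntegral_colourMul [NeZero L] (β : ℝ) {W : (Site 3 L → SU2) → ℝ} (hWinv : ∀ (c : SU2) (g : Site 3 L → SU2), W (fun x => c * g x) = W g)
    (c : SU2) (U V : GaugeConfig 3 L SU2) :
    ∫ g, W g * transferKernel su2Rep β U (gaugeTransform (fun x => c * g x) V) ∂gaugeMeasure L =
      ∫ g, W g * transferKernel su2Rep β U (gaugeTransform g V) ∂gaugeMeasure L := by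
  have h := integral_mul_left_eq_self (μ := gaugeMeasure L)
    (fun g : Site 3 L → SU2 => W (fun x => c⁻¹ * g x) * transferKernel su2Rep β U (gaugeTransform g V)) (fun _ => c)
  have e1 : ∀ g : Site 3 L → SU2, (fun x => c⁻¹ * ((fun _ : Site 3 L => c) * g) x) = g := fun g => by
    funext x; simp [Pi.mul_apply]
  have e2 : ∀ g : Site 3 L → SU2, ((fun _ : Site 3 L => c) * g) = fun x => c * g x := fun g => rfl
  simp only [e1] at h
  simp only [e2] at h
  rw [h]
  refine integral_congr_ae (ae_of_all _ fun g => ?_)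
  dsimp only
  rw [hWinv c⁻¹ g]
set_option maxHeartbeats 400000 in
/-- ★ **A colour-invariant weight leaves `fpBOKernel` SEPARATELY conjugation invariant in the left slow slot**: if `W(c·g) = W(g)` for all constants `c` and `Ω` is
colour blind, then `fpBOKernel β Ω W (cuc⁻¹) u' = fpBOKernel β Ω W u u'` for every `c ∈ SU(2)`.  (Invariance of `π` under constant colour rotations, `orthoTube (cuc⁻¹) (Ad_c v) =
c·(orthoTube u v)·c⁻¹`, `K_β(c·U·c⁻¹, V^g) = K_β(U, V^{c⁻¹g})`, and `gaugeIntegral_colourMul`.) [cite: SeilerLNP1982, §3] -/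
theorem fpBOKernel_conj_left (β : ℝ) {Ω : LinkSpace L → ℝ} (hΩm : Measurable Ω) (hΩinv : ∀ (g : SU2) (x : LinkSpace L), Ω (adL L g x) = Ω x)
    {W : (Site 3 L → SU2) → ℝ} (hW : Measurable W) (hWinv : ∀ (c : SU2) (g : Site 3 L → SU2), W (fun x => c * g x) = W g)
    (c : SU2) (u u' : GaugeConfig 3 1 SU2) :
    fpBOKernel L β Ω W (gaugeTransform (fun _ : Site 3 1 => c) u) u' = fpBOKernel L β Ω W u u' := by
  set u₀ : GaugeConfig 3 1 SU2 := gaugeTransform (fun _ : Site 3 1 => c) u with hu₀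
  set Ψ : (Edge 3 L → Fin 3 → ℝ) → ℝ := fun w => Ω (linkEmbed L w) *
    ∫ v', (∫ g, W g * transferKernel su2Rep β (orthoTube L u₀ w) (gaugeTransform g (orthoTube L u' v')) ∂gaugeMeasure L) *
      Ω (linkEmbed L v') ∂orthoTransverse L with hΨ
  have hΨm : Measurable Ψ := measurable_fpSection (L := L) β hΩm hW u₀ u'
  have hcap : ∀ᵐ v ∂orthoTransverse L, v ∈ capBalancedSet L := by
    rw [ae_iff]
    have h0 := orthoTransverse_compl_capBalancedSet L
    simpa only [Set.compl_def] using h0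
  show ∫ v, Ψ v ∂orthoTransverse L = _
  rw [← integral_orthoTransverse_colourRotate L (fun _ => c) Ψ hΨm]
  unfold fpBOKernel
  refine integral_congr_ae ?_
  filter_upwards [hcap] with v hv
  have hv1 : ∀ e : Edge 3 L, ∑ a, v e a ^ 2 ≤ 1 := sum_sq_le_one_of_cap L hv.2
  rw [hΨ]
  dsimp only
  rw [linkEmbed_colourRotate_const, hΩinv, hu₀, ← gaugeTransform_const_orthoTube c u hv1]
  congr 1
  refine integral_congr_ae (ae_of_all _ fun v' => ?_)
  dsimp only
  congr 1
  have e1 : ∀ g : Site 3 L → SU2, transferKernel su2Rep β (gaugeTransform (fun _ : Site 3 L => c) (orthoTube L u v)) (gaugeTransform g (orthoTube L u' v')) =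
      transferKernel su2Rep β (orthoTube L u v) (gaugeTransform (fun x => c⁻¹ * g x) (orthoTube L u' v')) := fun g => by
    rw [transferKernel_colourMul, inv_inv]
  simp_rw [e1]
  exact gaugeIntegral_colourMul β hWinv c⁻¹ _ _

/-- ★ **With the trivial weight the colour-localised BO kernel IS the BO kernel**: `𝒦_β(u,u') = fpBOKernel β Ω 1 u u'` (colour-blind bounded measurable `Ω`).  So the
trivial weight `W ≡ 1`, `Z = 1` satisfies every side condition of `boKernel_pointwise_of_fp` / `hT_of_fp`, and for it `hpt` compares `𝒦_β` with the RAW one-site kernel.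
[cite: Luscher1983, §3] -/
theorem boKernel_eq_fpBOKernel_one (β : ℝ) {Ω : LinkSpace L → ℝ} (hΩm : Measurable Ω) {CΩ : ℝ} (hCΩ : ∀ x, |Ω x| ≤ CΩ)
    (hΩinv : ∀ (g : SU2) (x : LinkSpace L), Ω (adL L g x) = Ω x) (u u' : GaugeConfig 3 1 SU2) :
    boKernel L β Ω u u' = fpBOKernel L β Ω (fun _ => 1) u u' := by
  have hW : Measurable fun _ : Site 3 L → SU2 => (1 : ℝ) := measurable_const
  have hZ : ∀ g : Site 3 L → SU2, ∫ c, (fun _ : Site 3 L → SU2 => (1 : ℝ)) (fun x => c * g x) ∂haarProbability SU2 = 1 := fun g => by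
    simp
  obtain ⟨-, hid⟩ := boKernel_fp (L := L) β hΩm hCΩ hΩinv hW (CW := 1) (fun _ => by simp) hZ u u'
  rw [one_mul] at hid
  rw [hid]
  have e : ∀ c : SU2, fpBOKernel L β Ω (fun _ => 1) (gaugeTransform (fun _ : Site 3 1 => c⁻¹) u) u' = fpBOKernel L β Ω (fun _ => 1) u u' := fun c =>
    fpBOKernel_conj_left β hΩm hΩinv hW (fun _ _ => rfl) c⁻¹ u u'
  simp_rw [e]
  simp

/-! ## §2 The one-site Weyl flip at a prescribed angle (`u_θ := (diagSU2 θ)_k : GaugeConfig 3 1 SU2`, written out in full to keep this file definition-free) -/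

/-- `orbitDist u_θ ≤ 3√2·|θ|`. [folklore] -/
theorem orbitDist_uDiag_le (θ : ℝ) : orbitDist (fun _ : Edge 3 1 => diagSU2 θ) ≤ 3 * Real.sqrt 2 * |θ| := by
  rw [orbitDist_one_site_eq]
  calc ∑ e : Edge 3 1, frobNorm ((((fun _ : Edge 3 1 => diagSU2 θ) e : SU2) : Matrix (Fin 2) (Fin 2) ℂ) - 1)
      ≤ ∑ _e : Edge 3 1, Real.sqrt 2 * |θ| := Finset.sum_le_sum fun e _ => frobNorm_diagSU2_sub_one_le θ
    _ = 3 * Real.sqrt 2 * |θ| := by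
      rw [Finset.sum_const, Finset.card_univ, nsmul_eq_mul]
      have hcard : (Fintype.card (Edge 3 1) : ℝ) = 3 := by
        rw [Summit.QuantumFields.YangMills.Theorems.TwistedTraceScaling.Negative.R36.card_edge_eq]
        simp
      rw [hcard]; ring

/-- `u_{−θ}` is a constant conjugate (Weyl flip) of `u_θ`. [cite: BrockerTomDieck1985, I (1.10)] -/
theorem exists_uDiag_neg_eq_conj : ∃ Wf : SU2, ∀ θ : ℝ, (fun _ : Edge 3 1 => diagSU2 (-θ)) = gaugeTransform (fun _ : Site 3 1 => Wf) (fun _ : Edge 3 1 => diagSU2 θ) := by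
  obtain ⟨Wf, hWf⟩ := exists_weylFlip
  exact ⟨Wf, fun θ => oneSite_diag_neg_eq_gaugeTransform hWf θ⟩

/-- ★ The RAW one-site kernel sees the flip at full kinetic cost: `K₁^{(B)}(u_{−θ}, u_θ) = e^{−B(2−2cos 2θ)|Edge 3 1|}·K₁^{(B)}(u_θ, u_θ)` (R32 at `L = 1`).
[cite: SeilerLNP1982, §3] -/
theorem transferKernel_uDiag_flip (B θ : ℝ) :
    transferKernel su2Rep B (fun _ : Edge 3 1 => diagSU2 (-θ)) (fun _ : Edge 3 1 => diagSU2 θ) =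
      Real.exp (-(B * (2 - 2 * Real.cos (2 * θ)) * Fintype.card (Edge 3 1))) * transferKernel su2Rep B (fun _ : Edge 3 1 => diagSU2 θ) (fun _ : Edge 3 1 => diagSU2 θ) := by
  have h := transferKernel_constDiag_flip (L := 1) B (-θ)
  rw [neg_neg, constLift_one, constLift_one] at h
  change transferKernel su2Rep B (fun _ : Edge 3 1 => diagSU2 (-θ)) (fun _ : Edge 3 1 => diagSU2 θ) = _ * transferKernel su2Rep B (fun _ : Edge 3 1 => diagSU2 (-θ)) (fun _ : Edge 3 1 => diagSU2 (-θ)) at h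
  rw [h]
  obtain ⟨Wf, hWf⟩ := exists_uDiag_neg_eq_conj
  rw [hWf θ, transferKernel_gaugeTransform, show 2 * -θ = -(2 * θ) by ring, Real.cos_neg]

/-- `K₁^{(B)}(u_{−θ}, u_θ) ≤ e^{−Bθ²}·K₁^{(B)}(u_θ, u_θ)` for `0 ≤ θ ≤ π/2`, `0 ≤ B`. [folklore] -/
theorem transferKernel_uDiag_flip_le {B θ : ℝ} (hB : 0 ≤ B) (h0 : 0 ≤ θ) (h1 : θ ≤ π / 2) :
    transferKernel su2Rep B (fun _ : Edge 3 1 => diagSU2 (-θ)) (fun _ : Edge 3 1 => diagSU2 θ) ≤ Real.exp (-(B * θ ^ 2)) * transferKernel su2Rep B (fun _ : Edge 3 1 => diagSU2 θ) (fun _ : Edge 3 1 => diagSU2 θ) := by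
  rw [transferKernel_uDiag_flip]
  refine mul_le_mul_of_nonneg_right ?_ (transferKernel_pos su2Rep B _ _).le
  rw [Real.exp_le_exp, neg_le_neg_iff]
  have hkin : θ ^ 2 ≤ 2 - 2 * Real.cos (2 * θ) := sq_le_two_sub_two_cos_two_mul h0 h1
  have hcard : (1 : ℝ) ≤ Fintype.card (Edge 3 1) := by exact_mod_cast Fintype.card_pos
  have hk0 : 0 ≤ B * (2 - 2 * Real.cos (2 * θ)) := mul_nonneg hB ((sq_nonneg θ).trans hkin)
  calc B * θ ^ 2 ≤ B * (2 - 2 * Real.cos (2 * θ)) := mul_le_mul_of_nonneg_left hkin hB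
    _ = B * (2 - 2 * Real.cos (2 * θ)) * 1 := (mul_one _).symm
    _ ≤ B * (2 - 2 * Real.cos (2 * θ)) * Fintype.card (Edge 3 1) := mul_le_mul_of_nonneg_left hcard hk0

/-! ## §3 ★★ What `hpt` forces at a flip pair in the window -/

/-- ★★ **The flip constraint.**  If `W` is left-colour invariant, `Ω` colour blind, `C > 0`, and the pointwise hypothesis `hpt` of `boKernel_pointwise_of_fp` holds on the window
`{orbitDist < δ}` with constant `κ`, then for every angle with `3√2|θ| < δ`: `1 − κ ≤ (1 + κ)·exp(−B(2−2cos 2θ)|Edge 3 1|)`.  (At `(u_θ,u_θ)` and `(u_{−θ},u_θ)` the left sides of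
`hpt` agree by `fpBOKernel_conj_left`, the targets differ by the displayed factor.) [cite: SeilerLNP1982, §3] -/
theorem flip_constraint_of_hpt (β B : ℝ) {Ω : LinkSpace L → ℝ} (hΩm : Measurable Ω) (hΩinv : ∀ (g : SU2) (x : LinkSpace L), Ω (adL L g x) = Ω x)
    {W : (Site 3 L → SU2) → ℝ} (hW : Measurable W) (hWinv : ∀ (c : SU2) (g : Site 3 L → SU2), W (fun x => c * g x) = W g)
    {C κ δ : ℝ} (hC : 0 < C)
    (hpt : ∀ u u' : GaugeConfig 3 1 SU2, orbitDist u < δ → orbitDist u' < δ →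
      |fpBOKernel L β Ω W u u' - C * transferKernel su2Rep B u u'| ≤ κ * C * transferKernel su2Rep B u u')
    {θ : ℝ} (hθ : 3 * Real.sqrt 2 * |θ| < δ) :
    1 - κ ≤ (1 + κ) * Real.exp (-(B * (2 - 2 * Real.cos (2 * θ)) * Fintype.card (Edge 3 1))) := by
  have hin : ∀ t : ℝ, |t| = |θ| → orbitDist (fun _ : Edge 3 1 => diagSU2 t) < δ := fun t ht => (orbitDist_uDiag_le t).trans_lt (by rw [ht]; exact hθ)
  have hθin : orbitDist (fun _ : Edge 3 1 => diagSU2 θ) < δ := hin θ rfl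
  have hθin' : orbitDist (fun _ : Edge 3 1 => diagSU2 (-θ)) < δ := hin (-θ) (abs_neg θ)
  set K : ℝ := transferKernel su2Rep B (fun _ : Edge 3 1 => diagSU2 θ) (fun _ : Edge 3 1 => diagSU2 θ) with hK
  have hK0 : 0 < K := transferKernel_pos su2Rep B _ _
  set E : ℝ := Real.exp (-(B * (2 - 2 * Real.cos (2 * θ)) * Fintype.card (Edge 3 1))) with hE
  -- lower bound at the diagonal pair
  have h1 := hpt (fun _ : Edge 3 1 => diagSU2 θ) (fun _ : Edge 3 1 => diagSU2 θ) hθin hθin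
  have hlow : (1 - κ) * (C * K) ≤ fpBOKernel L β Ω W (fun _ : Edge 3 1 => diagSU2 θ) (fun _ : Edge 3 1 => diagSU2 θ) := by
    have := (abs_le.mp h1).1
    rw [hK]; linarith
  -- upper bound at the flipped pair, whose left side agrees with the diagonal one
  have h2 := hpt (fun _ : Edge 3 1 => diagSU2 (-θ)) (fun _ : Edge 3 1 => diagSU2 θ) hθin' hθin
  obtain ⟨Wf, hWf⟩ := exists_uDiag_neg_eq_conj
  have hsame : fpBOKernel L β Ω W (fun _ : Edge 3 1 => diagSU2 (-θ)) (fun _ : Edge 3 1 => diagSU2 θ) = fpBOKernel L β Ω W (fun _ : Edge 3 1 => diagSU2 θ) (fun _ : Edge 3 1 => diagSU2 θ) := by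
    rw [hWf θ]; exact fpBOKernel_conj_left β hΩm hΩinv hW hWinv Wf _ _
  have hflip : transferKernel su2Rep B (fun _ : Edge 3 1 => diagSU2 (-θ)) (fun _ : Edge 3 1 => diagSU2 θ) = E * K := by rw [hE, hK]; exact transferKernel_uDiag_flip B θ
  have hup : fpBOKernel L β Ω W (fun _ : Edge 3 1 => diagSU2 θ) (fun _ : Edge 3 1 => diagSU2 θ) ≤ (1 + κ) * (C * (E * K)) := by
    have := (abs_le.mp h2).2
    rw [hsame, hflip] at this
    linarith
  have hCK : 0 < C * K := mul_pos hC hK0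
  have hchain : (1 - κ) * (C * K) ≤ ((1 + κ) * E) * (C * K) := by nlinarith
  exact le_of_mul_le_mul_right hchain hCK

/-! ## §4 ★★★ The `∀ᶠ β` hypothesis of `hT_of_fp` is unsatisfiable for colour-invariant weights on the record window -/

/-- ★★★ **NO colour-invariant Faddeev–Popov weight.**  For `0 ≤ s < 1/2`, colour-blind measurable `Ω β`, measurable LEFT-COLOUR-INVARIANT weights `W β` (`W β (c·g) = W β g`),
eventual normalisations `C β > 0` and precisions `κ β ≤ κ₀ < 1`, the hypothesis `hpt` of `hT_of_fp` — `∀ᶠ β, ∀ u u' ∈ {orbitDist < recordDelta1 L s β}: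
|fpBOKernel β (Ω β) (W β) u u' − C β·K₁^{(L³β)}(u,u')| ≤ κ β·C β·K₁^{(L³β)}(u,u')` — is FALSE: at `θ_β = β^{−s}/|Site|` the flip pair `u_{±θ_β}` lies in the window and
`flip_constraint_of_hpt` would give `1 − κ₀ ≤ 2·exp(−L³β^{1−2s}/|Site|²) → 0`. [cite: SeilerLNP1982, §3] -/
theorem not_hpt_of_colourInvariant {s : ℝ} (hs0 : 0 ≤ s) (hs : s < 1 / 2) {Ω : ℝ → LinkSpace L → ℝ} (hΩm : ∀ β, Measurable (Ω β))
    (hΩinv : ∀ β (g : SU2) (x : LinkSpace L), Ω β (adL L g x) = Ω β x)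
    {W : ℝ → (Site 3 L → SU2) → ℝ} (hW : ∀ β, Measurable (W β)) (hWinv : ∀ β (c : SU2) (g : Site 3 L → SU2), W β (fun x => c * g x) = W β g)
    {C κ : ℝ → ℝ} (hC : ∀ᶠ β : ℝ in atTop, 0 < C β) {κ₀ : ℝ} (hκ₀ : κ₀ < 1) (hκ : ∀ᶠ β : ℝ in atTop, κ β ≤ κ₀) :
    ¬ (∀ᶠ β : ℝ in atTop, ∀ u u' : GaugeConfig 3 1 SU2, orbitDist u < recordDelta1 L s β → orbitDist u' < recordDelta1 L s β →
      |fpBOKernel L β (Ω β) (W β) u u' - C β * transferKernel su2Rep ((L : ℝ) ^ 3 * β) u u'| ≤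
        κ β * C β * transferKernel su2Rep ((L : ℝ) ^ 3 * β) u u') := by
  intro hpt
  -- constants
  set N : ℝ := (Fintype.card (Site 3 L) : ℝ) with hN
  have hN0 : 0 < N := by rw [hN]; exact_mod_cast Fintype.card_pos
  have hL1 : (1 : ℝ) ≤ (L : ℝ) := by exact_mod_cast Nat.one_le_iff_ne_zero.mpr (NeZero.ne L)
  have hL3 : (1 : ℝ) ≤ (L : ℝ) ^ 3 := one_le_pow₀ hL1
  have hq : 0 < 1 - 2 * s := by linarith
  have hgap : 0 < 1 - κ₀ := by linarith
  -- the threshold: `L³ β^{1−2s} / N² > log (2/(1−κ₀))`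
  set T : ℝ := N ^ 2 * (max (Real.log (2 / (1 - κ₀))) 0 + 1) with hT
  have hT0 : 0 < T := by positivity
  obtain ⟨β₀, hβ₀⟩ := rpow_neg_eventually_le hq (inv_pos.mpr hT0)
  obtain ⟨β, hβpt, hCβ, hκβ, hββ₀⟩ := (hpt.and (hC.and (hκ.and (eventually_ge_atTop β₀)))).exists
  obtain ⟨hβ1, hβT⟩ := hβ₀ β hββ₀
  have hβ0 : 0 < β := by linarith
  -- the angle
  have hδ : powScale s β = β ^ (-s) := powScale_eq hβ1
  have hδ0 : 0 < powScale s β := powScale_pos s β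
  have hδ1 : powScale s β ≤ 1 := powScale_le_one hs0 β
  set θ : ℝ := powScale s β / N with hθ
  have hθ0 : 0 < θ := by positivity
  have hN1 : 1 ≤ N := by rw [hN]; exact_mod_cast Fintype.card_pos
  have hθle1 : θ ≤ 1 := by
    rw [hθ, div_le_one hN0]; exact hδ1.trans hN1
  have hθpi : θ ≤ π / 2 := by linarith [Real.pi_gt_three]
  have hs2 : Real.sqrt 2 < 2 := (Real.sqrt_lt' (by norm_num)).mpr (by norm_num)
  have hwin : 3 * Real.sqrt 2 * |θ| < recordDelta1 L s β := by
    rw [abs_of_pos hθ0, hθ]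
    unfold recordDelta1
    rw [← hN]
    have : 3 * Real.sqrt 2 * (powScale s β / N) = (3 * Real.sqrt 2) * powScale s β / N := by ring
    rw [this]
    exact div_lt_div_of_pos_right (by nlinarith) hN0
  -- the flip constraint at this `β`
  have hcon := flip_constraint_of_hpt (L := L) β ((L : ℝ) ^ 3 * β) (hΩm β) (hΩinv β) (hW β) (hWinv β) hCβ hβpt hwin
  -- `κ β ≥ 0` from `hpt` at the diagonal pair
  have hκ0 : 0 ≤ κ β := by
    have hin : orbitDist (fun _ : Edge 3 1 => diagSU2 θ) < recordDelta1 L s β := (orbitDist_uDiag_le θ).trans_lt hwin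
    have h := hβpt (fun _ : Edge 3 1 => diagSU2 θ) (fun _ : Edge 3 1 => diagSU2 θ) hin hin
    have hK0 := transferKernel_pos su2Rep ((L : ℝ) ^ 3 * β) (fun _ : Edge 3 1 => diagSU2 θ) (fun _ : Edge 3 1 => diagSU2 θ)
    have h' : 0 ≤ κ β * C β * transferKernel su2Rep ((L : ℝ) ^ 3 * β) (fun _ : Edge 3 1 => diagSU2 θ) (fun _ : Edge 3 1 => diagSU2 θ) := (abs_nonneg _).trans h
    have h'' : 0 ≤ κ β * (C β * transferKernel su2Rep ((L : ℝ) ^ 3 * β) (fun _ : Edge 3 1 => diagSU2 θ) (fun _ : Edge 3 1 => diagSU2 θ)) := by rw [← mul_assoc]; exact h'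
    exact nonneg_of_mul_nonneg_left h'' (mul_pos hCβ hK0)
  -- the exponent is large: `(L³β)·θ² ≤ (L³β)(2 − 2cos 2θ)|Edge 3 1|` and `(L³β)θ² = L³ β^{1−2s}/N² ≥ T/N²`
  have hB0 : 0 ≤ (L : ℝ) ^ 3 * β := by positivity
  have hE : Real.exp (-((L : ℝ) ^ 3 * β * (2 - 2 * Real.cos (2 * θ)) * Fintype.card (Edge 3 1))) ≤ Real.exp (-((L : ℝ) ^ 3 * β * θ ^ 2)) := by
    rw [Real.exp_le_exp, neg_le_neg_iff]
    have hkin : θ ^ 2 ≤ 2 - 2 * Real.cos (2 * θ) := sq_le_two_sub_two_cos_two_mul hθ0.le hθpi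
    have hcard : (1 : ℝ) ≤ Fintype.card (Edge 3 1) := by exact_mod_cast Fintype.card_pos
    have hk0 : 0 ≤ (L : ℝ) ^ 3 * β * (2 - 2 * Real.cos (2 * θ)) := mul_nonneg hB0 ((sq_nonneg θ).trans hkin)
    calc (L : ℝ) ^ 3 * β * θ ^ 2 ≤ (L : ℝ) ^ 3 * β * (2 - 2 * Real.cos (2 * θ)) := mul_le_mul_of_nonneg_left hkin hB0
      _ = (L : ℝ) ^ 3 * β * (2 - 2 * Real.cos (2 * θ)) * 1 := (mul_one _).symm
      _ ≤ (L : ℝ) ^ 3 * β * (2 - 2 * Real.cos (2 * θ)) * Fintype.card (Edge 3 1) := mul_le_mul_of_nonneg_left hcard hk0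
  have hpow : T ≤ β ^ (1 - 2 * s) := by
    have h := hβT
    rw [Real.rpow_neg hβ0.le] at h
    rwa [inv_le_inv₀ (Real.rpow_pos_of_pos hβ0 _) hT0] at h
  have hβθ : (L : ℝ) ^ 3 * β * θ ^ 2 = (L : ℝ) ^ 3 * (β ^ (1 - 2 * s) / N ^ 2) := by
    rw [hθ, hδ, div_pow, ← Real.rpow_natCast (β ^ (-s)) 2, ← Real.rpow_mul hβ0.le]
    have e : β ^ (1 - 2 * s) = β * β ^ (-s * ((2 : ℕ) : ℝ)) := by
      rw [show (1 : ℝ) - 2 * s = 1 + -s * ((2 : ℕ) : ℝ) by push_cast; ring, Real.rpow_add hβ0, Real.rpow_one]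
    rw [e]; ring
  have hX : max (Real.log (2 / (1 - κ₀))) 0 + 1 ≤ (L : ℝ) ^ 3 * β * θ ^ 2 := by
    rw [hβθ]
    have h1 : T / N ^ 2 ≤ β ^ (1 - 2 * s) / N ^ 2 := div_le_div_of_nonneg_right hpow (by positivity)
    have h2 : T / N ^ 2 = max (Real.log (2 / (1 - κ₀))) 0 + 1 := by rw [hT]; field_simp
    have h3 : β ^ (1 - 2 * s) / N ^ 2 ≤ (L : ℝ) ^ 3 * (β ^ (1 - 2 * s) / N ^ 2) :=
      le_mul_of_one_le_left (div_nonneg (Real.rpow_nonneg hβ0.le _) (by positivity)) hL3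
    linarith
  -- contradiction: `1 − κ₀ ≤ 1 − κ β ≤ (1 + κ β)·e^{−X} ≤ 2e^{−X} < 1 − κ₀`
  have hlt : 2 * Real.exp (-((L : ℝ) ^ 3 * β * θ ^ 2)) < 1 - κ₀ := by
    have hlog : Real.log (2 / (1 - κ₀)) < (L : ℝ) ^ 3 * β * θ ^ 2 := by
      have := le_max_left (Real.log (2 / (1 - κ₀))) 0; linarith
    have h2 : 2 / (1 - κ₀) < Real.exp ((L : ℝ) ^ 3 * β * θ ^ 2) := by
      rw [← Real.exp_log (show 0 < 2 / (1 - κ₀) by positivity)]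
      exact Real.exp_lt_exp.mpr hlog
    rw [Real.exp_neg]
    have hpos : 0 < Real.exp ((L : ℝ) ^ 3 * β * θ ^ 2) := Real.exp_pos _
    rw [div_lt_iff₀ hgap] at h2
    rw [mul_inv_lt_iff₀ hpos]
    linarith
  have h1 : 1 - κ β ≤ (1 + κ β) * Real.exp (-((L : ℝ) ^ 3 * β * θ ^ 2)) :=
    hcon.trans (mul_le_mul_of_nonneg_left hE (by linarith))
  have h2 : (1 + κ β) * Real.exp (-((L : ℝ) ^ 3 * β * θ ^ 2)) ≤ 2 * Real.exp (-((L : ℝ) ^ 3 * β * θ ^ 2)) :=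
    mul_le_mul_of_nonneg_right (by linarith) (Real.exp_pos _).le
  linarith

/-- ★★★ **In particular for the TRIVIAL weight**: a pointwise two-sided comparison of lane A's BO kernel `𝒦_β` with the RAW one-site kernel at the record coupling on the
record window, `∀ᶠ β, ∀ u u' ∈ window: |𝒦_β(u,u') − C β·K₁^{(L³β)}(u,u')| ≤ κ β·C β·K₁^{(L³β)}(u,u')` with eventual `C β > 0`, `κ β ≤ κ₀ < 1`, is impossible for colour-blind
bounded measurable `Ω β` (`0 ≤ s < 1/2`) — R32's «no LAB slow factor» for the BO kernel of record. [cite: Luscher1983, §3] -/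
theorem not_hpt_trivial_weight {s : ℝ} (hs0 : 0 ≤ s) (hs : s < 1 / 2) {Ω : ℝ → LinkSpace L → ℝ} (hΩm : ∀ β, Measurable (Ω β))
    {CΩ : ℝ → ℝ} (hCΩ : ∀ β x, |Ω β x| ≤ CΩ β) (hΩinv : ∀ β (g : SU2) (x : LinkSpace L), Ω β (adL L g x) = Ω β x)
    {C κ : ℝ → ℝ} (hC : ∀ᶠ β : ℝ in atTop, 0 < C β) {κ₀ : ℝ} (hκ₀ : κ₀ < 1) (hκ : ∀ᶠ β : ℝ in atTop, κ β ≤ κ₀) :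
    ¬ (∀ᶠ β : ℝ in atTop, ∀ u u' : GaugeConfig 3 1 SU2, orbitDist u < recordDelta1 L s β → orbitDist u' < recordDelta1 L s β →
      |boKernel L β (Ω β) u u' - C β * transferKernel su2Rep ((L : ℝ) ^ 3 * β) u u'| ≤
        κ β * C β * transferKernel su2Rep ((L : ℝ) ^ 3 * β) u u') := by
  intro h
  refine not_hpt_of_colourInvariant (L := L) hs0 hs hΩm hΩinv (W := fun _ _ => (1 : ℝ)) (fun _ => measurable_const) (fun _ _ _ => rfl) hC hκ₀ hκ ?_
  filter_upwards [h] with β hβ u u' hu hu'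
  rw [← boKernel_eq_fpBOKernel_one β (hΩm β) (hCΩ β) (hΩinv β)]
  exact hβ u u' hu hu'

end Summit.QuantumFields.YangMills.Theorems.TwistedTraceScaling.Negative.R38

end
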